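import Summits.CriticalPhenomena.PercolationContinuityZ3.Theorems.PercNearOneGluingNoHeavyLowerTailAntitheticUConeZones
import HarnessLib

/-!
# `NoHeavyLowerTail` (stmt-CriticalPhenomena-4575) — antithetic cluster pairs: the zone system of THEOREM U — part 2: the LARGE/SMALL
# dichotomy and CONSISTENCY (prim-hp-2 gen 37; HOME/THEOREM-U-universal.md)

Support file (`--supports stmt-CriticalPhenomena-4575`, hull-port prover `prim-hp-2`, gen 37).  No definitions, no named facts, no sorries;
standard axioms.  Setting and rule: `…AntitheticUConeZones` (universal vertex `k₀ ≠ s`).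

DICHOTOMY (`UCone.blueCluster_of_beta`): a red zone is a blue cluster `C_b(w)` with `w` not blue-reached, and either LARGE (it contains a
reached vertex of `R`) or SMALL (`r` unreached and unswallowed, spoke `s k₀` blue, `w = r`; then the zone is entirely unreached).  Mirror
image for blue zones (`redCluster_of_not_beta`).  CONSISTENCY (`UCone.consistent`): blocks of a red and a blue zone share no edge — a common
vertex `z` is unreached, so its own cluster is entirely unreached (it is one of the two zones, which is then not LARGE) and its hub cluster
is the other one (which is then LARGE, making everything swallowed) — and without a common vertex the shared edge is a boundary edge of both.
[cite: VandenbergHaggstromKahn2005, §1 p. 3 (open cluster `C_s`)]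
-/

noncomputable section

namespace Summit.CriticalPhenomena.PercolationContinuityZ3.Theorems

open Literature.Probability.Percolation
open scoped Classical symmDiff

namespace Antithetic

namespace UCone

section Consistency

variable {V : Type*} {E : Set (Sym2 V)} {s k₀ : V} {R : Set V} {T : Set (Sym2 V)} {r : V}

/-- **Dichotomy for a red zone**: it is a blue cluster of a vertex that is not blue-reached, LARGE (containing a reached `R`-vertex) or SMALL
(`r` unreached, unswallowed, spoke `s k₀` blue). [this work] -/
theorem blueCluster_of_beta (hk : k₀ ≠ s) (huniv : ∀ v, v ≠ k₀ → s(k₀, v) ∈ E) (hrR : r ∈ R)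
    (hD : ¬ ((openGraph (T ∩ E)).Reachable s r ∧ (openGraph (Tᶜ ∩ E)).Reachable s r)) (hβ : r ∈ beta E s k₀ R T) :
    ∃ w, zone E s k₀ R T r = openCluster (Tᶜ ∩ E) w ∧ ¬ (openGraph (Tᶜ ∩ E)).Reachable s w ∧
      ((∃ q ∈ R, ((openGraph (T ∩ E)).Reachable s q ∨ (openGraph (Tᶜ ∩ E)).Reachable s q) ∧ q ∈ openCluster (Tᶜ ∩ E) w) ∨
        (¬ (openGraph (T ∩ E)).Reachable s r ∧ ¬ (openGraph (Tᶜ ∩ E)).Reachable s r ∧ T ∉ swSet E s k₀ R ∧ s(s, k₀) ∉ T ∧ w = r)) := by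
  by_cases hr : (openGraph (T ∩ E)).Reachable s r
  · exact ⟨r, zone_of_red hD hr, fun h => hD ⟨hr, h⟩, Or.inl ⟨r, hrR, Or.inl hr, mem_openCluster_self _ _⟩⟩
  · by_cases hb : (openGraph (Tᶜ ∩ E)).Reachable s r
    · exact absurd hβ (not_beta_of_blue hD hb)
    · rw [beta_iff_of_none hr hb] at hβ
      by_cases hsw : T ∈ swSet E s k₀ R
      · have hsT : s(s, k₀) ∈ T := hβ.1 hsw
        obtain ⟨q, hqR, hq, hqh⟩ := hsw
        refine ⟨k₀, by rw [zone_of_sw hk huniv hr hb ⟨q, hqR, hq, hqh⟩, hub_of_red hsT], (hub_not_reached hk huniv hr hb).1 hsT,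
          Or.inl ⟨q, hqR, hq, by rw [← hub_of_red hsT]; exact hqh⟩⟩
      · have hsT : s(s, k₀) ∉ T := fun h => hsw (hβ.2 h)
        exact ⟨r, by rw [zone_of_small hr hb hsw, own_of_blue hsT], hb, Or.inr ⟨hr, hb, hsw, hsT, rfl⟩⟩

/-- **Dichotomy for a blue zone** (mirror image, via the colour swap). [this work] -/
theorem redCluster_of_not_beta (hk : k₀ ≠ s) (huniv : ∀ v, v ≠ k₀ → s(k₀, v) ∈ E) (hrR : r ∈ R)
    (hD : ¬ ((openGraph (T ∩ E)).Reachable s r ∧ (openGraph (Tᶜ ∩ E)).Reachable s r)) (hβ : r ∉ beta E s k₀ R T) :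
    ∃ w, zone E s k₀ R T r = openCluster (T ∩ E) w ∧ ¬ (openGraph (T ∩ E)).Reachable s w ∧
      ((∃ q ∈ R, ((openGraph (T ∩ E)).Reachable s q ∨ (openGraph (Tᶜ ∩ E)).Reachable s q) ∧ q ∈ openCluster (T ∩ E) w) ∨
        (¬ (openGraph (T ∩ E)).Reachable s r ∧ ¬ (openGraph (Tᶜ ∩ E)).Reachable s r ∧ T ∉ swSet E s k₀ R ∧ s(s, k₀) ∈ T ∧ w = r)) := by
  have hD' : ¬ ((openGraph (Tᶜ ∩ E)).Reachable s r ∧ (openGraph (Tᶜᶜ ∩ E)).Reachable s r) := by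
    rw [compl_compl]; exact fun h => hD ⟨h.2, h.1⟩
  have hβ' : r ∈ beta E s k₀ R Tᶜ := (beta_compl hD).2 hβ
  obtain ⟨w, hZ, hnb, h⟩ := blueCluster_of_beta hk huniv hrR hD' hβ'
  rw [zone_compl, compl_compl] at hZ
  rw [compl_compl] at hnb
  refine ⟨w, hZ, hnb, ?_⟩
  rcases h with ⟨q, hqR, hq, hqm⟩ | ⟨hb, hr, hsw, hsT, hw⟩
  · rw [compl_compl] at hq hqm
    exact Or.inl ⟨q, hqR, hq.symm, hqm⟩
  · rw [compl_compl] at hr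
    rw [sw_compl] at hsw
    exact Or.inr ⟨hr, hb, hsw, not_not.1 hsT, hw⟩

/-- **No common vertex**: with a universal vertex `k₀ ≠ s`, a red zone (as a blue cluster) and a blue zone (as a red cluster) are disjoint.
[this work] -/
theorem false_of_common (hk : k₀ ≠ s) (huniv : ∀ v, v ≠ k₀ → s(k₀, v) ∈ E) {u v w w' z : V}
    (hnbw : ¬ (openGraph (Tᶜ ∩ E)).Reachable s w) (hnrw' : ¬ (openGraph (T ∩ E)).Reachable s w')
    (hU : (∃ q ∈ R, ((openGraph (T ∩ E)).Reachable s q ∨ (openGraph (Tᶜ ∩ E)).Reachable s q) ∧ q ∈ openCluster (Tᶜ ∩ E) w) ∨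
      (¬ (openGraph (T ∩ E)).Reachable s u ∧ ¬ (openGraph (Tᶜ ∩ E)).Reachable s u ∧ T ∉ swSet E s k₀ R ∧ s(s, k₀) ∉ T ∧ w = u))
    (hV : (∃ q ∈ R, ((openGraph (T ∩ E)).Reachable s q ∨ (openGraph (Tᶜ ∩ E)).Reachable s q) ∧ q ∈ openCluster (T ∩ E) w') ∨
      (¬ (openGraph (T ∩ E)).Reachable s v ∧ ¬ (openGraph (Tᶜ ∩ E)).Reachable s v ∧ T ∉ swSet E s k₀ R ∧ s(s, k₀) ∈ T ∧ w' = v))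
    (hzu : z ∈ openCluster (Tᶜ ∩ E) w) (hzv : z ∈ openCluster (T ∩ E) w') : False := by
  have hzb : ¬ (openGraph (Tᶜ ∩ E)).Reachable s z := not_reachable_of_mem_openCluster _ hzu hnbw
  have hzr : ¬ (openGraph (T ∩ E)).Reachable s z := not_reachable_of_mem_openCluster _ hzv hnrw'
  have hcb : openCluster (Tᶜ ∩ E) z = openCluster (Tᶜ ∩ E) w := openCluster_eq_of_mem _ hzu
  have hcr : openCluster (T ∩ E) z = openCluster (T ∩ E) w' := openCluster_eq_of_mem _ hzv
  have hzh := mem_hub hk huniv hzr hzb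
  by_cases hsT : s(s, k₀) ∈ T
  · -- own z = red cluster of z = the blue zone; hub = blue cluster of z = the red zone
    have hown : own E s k₀ T z = openCluster (T ∩ E) w' := by rw [own_of_red hsT, hcr]
    rw [hub_of_red hsT] at hzh
    have hhub : openCluster (Tᶜ ∩ E) k₀ = openCluster (Tᶜ ∩ E) w := by rw [← openCluster_eq_of_mem _ hzh, hcb]
    rcases hV with ⟨q, -, hq, hqm⟩ | ⟨-, -, hswv, -, -⟩
    · rw [← hown] at hqm
      exact hq.elim (own_unreached hk huniv hzr hzb hqm).1 (own_unreached hk huniv hzr hzb hqm).2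
    · rcases hU with ⟨q, hqR, hq, hqm⟩ | ⟨-, -, -, hsT', -⟩
      · exact hswv ⟨q, hqR, hq, by rw [hub_of_red hsT, hhub]; exact hqm⟩
      · exact hsT' hsT
  · have hown : own E s k₀ T z = openCluster (Tᶜ ∩ E) w := by rw [own_of_blue hsT, hcb]
    rw [hub_of_blue hsT] at hzh
    have hhub : openCluster (T ∩ E) k₀ = openCluster (T ∩ E) w' := by rw [← openCluster_eq_of_mem _ hzh, hcr]
    rcases hU with ⟨q, -, hq, hqm⟩ | ⟨-, -, hswu, -, -⟩
    · rw [← hown] at hqm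
      exact hq.elim (own_unreached hk huniv hzr hzb hqm).1 (own_unreached hk huniv hzr hzb hqm).2
    · rcases hV with ⟨q, hqR, hq, hqm⟩ | ⟨-, -, -, hsT', -⟩
      · exact hswu ⟨q, hqR, hq, by rw [hub_of_blue hsT, hhub]; exact hqm⟩
      · exact hsT hsT'

/-- **Asymmetric consistency**: a red zone and a blue zone of `R`-vertices have edge-disjoint blocks. [this work] -/
theorem false_of_beta_of_not_beta (hk : k₀ ≠ s) (huniv : ∀ v, v ≠ k₀ → s(k₀, v) ∈ E)
    (hT : ∀ r ∈ R, ¬ ((openGraph (T ∩ E)).Reachable s r ∧ (openGraph (Tᶜ ∩ E)).Reachable s r))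
    {u v : V} (hu : u ∈ R) (hv : v ∈ R) {e : Sym2 V}
    (heu : e ∈ ZoneSys.blk E (zone E s k₀ R T u)) (hev : e ∈ ZoneSys.blk E (zone E s k₀ R T v))
    (hbu : u ∈ beta E s k₀ R T) (hbv : v ∉ beta E s k₀ R T) : False := by
  obtain ⟨heE, -, a, hau, hae⟩ := heu
  obtain ⟨-, -, c, hcv, hce⟩ := hev
  obtain ⟨w, hZu, hnbw, hU⟩ := blueCluster_of_beta hk huniv hu (hT u hu) hbu
  obtain ⟨w', hZv, hnrw', hV⟩ := redCluster_of_not_beta hk huniv hv (hT v hv) hbv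
  rw [hZu] at hau
  rw [hZv] at hcv
  by_cases hc : c ∈ openCluster (Tᶜ ∩ E) w
  · exact false_of_common hk huniv hnbw hnrw' hU hV hc hcv
  · by_cases ha : a ∈ openCluster (T ∩ E) w'
    · exact false_of_common hk huniv hnbw hnrw' hU hV hau ha
    · have hac : a ≠ c := by
        rintro rfl
        exact hc hau
      rw [ACone.eq_mk_of_mem_mem hae hce hac] at heE
      have h1 := not_mem_of_boundary (Tᶜ ∩ E) w hc hau
      have h2 := not_mem_of_boundary (T ∩ E) w' ha hcv
      have hca : s(c, a) ∈ E := by rw [Sym2.eq_swap]; exact heE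
      have hred : s(c, a) ∈ T := by
        by_contra h
        exact h1 ⟨h, hca⟩
      exact h2 ⟨by rw [Sym2.eq_swap]; exact hred, heE⟩

/-- **Consistency of the zone system of THEOREM U**: two zones of `R`-vertices whose blocks share an edge have the same colour. [this work] -/
theorem consistent (hk : k₀ ≠ s) (huniv : ∀ v, v ≠ k₀ → s(k₀, v) ∈ E)
    (hT : ∀ r ∈ R, ¬ ((openGraph (T ∩ E)).Reachable s r ∧ (openGraph (Tᶜ ∩ E)).Reachable s r))
    {u v : V} (hu : u ∈ R) (hv : v ∈ R) {e : Sym2 V}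
    (heu : e ∈ ZoneSys.blk E (zone E s k₀ R T u)) (hev : e ∈ ZoneSys.blk E (zone E s k₀ R T v)) :
    (u ∈ beta E s k₀ R T ↔ v ∈ beta E s k₀ R T) := by
  by_cases hbu : u ∈ beta E s k₀ R T
  · by_cases hbv : v ∈ beta E s k₀ R T
    · exact iff_of_true hbu hbv
    · exact (false_of_beta_of_not_beta hk huniv hT hu hv heu hev hbu hbv).elim
  · by_cases hbv : v ∈ beta E s k₀ R T
    · exact (false_of_beta_of_not_beta hk huniv hT hv hu hev heu hbv hbu).elim
    · exact iff_of_false hbu hbv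

end Consistency

end UCone

end Antithetic

end Summit.CriticalPhenomena.PercolationContinuityZ3.Theorems
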